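import Mathlib
import Summits.Schanuel.Schanuel.Theorems.AclSubsetLogFreeCore.Negative.ExpAclDefinability

/-!
# Crux `AclSubsetLogFreeCore` ⟺ every `∅`-definable REAL number of `ℂ_exp` lies in `C_EA`

Theorems for the crux (A) `RigidCore.AclSubsetLogFreeCore` (stmt-Schanuel-0968), all proved:

* `∅`-definable sets of `ℂ_exp` are stable under complex conjugation
  (`conj_comp_mem_of_definable`, via the automorphism `conjLEquiv`); hence **`dcl^{ℂ_exp}(∅) ⊆ ℝ`**
  (`expDcl_subset_range_ofReal`), `2πi ∉ dcl(∅)` and `C_EA ⊄ dcl(∅)`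
  (`not_logFreeCore_subset_expDcl`: the core is not made of pointwise-definable numbers);
* the elementary symmetric functions of a finite `∅`-definable set are `∅`-definable POINTS
  (`coeff_mem_expDcl`; integer polynomial maps are definable, `definableFun_mvPolynomial_aeval`),
  so `acl(∅)` is algebraic over `dcl(∅)` with definable coefficients and, `C_EA` being relatively
  algebraically closed, **(A) ⟺ `dcl(∅) ⊆ C_EA`** (`aclSubsetLogFreeCore_iff_expDcl`) **⟺ every
  `∅`-definable real is in `C_EA`** (`aclSubsetLogFreeCore_iff_real`);
* `countable_expAcl`: `acl(∅)` is countable — with `countable_logFreeCore`, no counting argument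
  (and no known automorphism) separates the two sides of (A).

## References

* [KirbyMacintyreOnshuus2012] J. Kirby, A. Macintyre, A. Onshuus, *The algebraic numbers definable
  in various exponential fields*, J. Inst. Math. Jussieu 11 (2012) 825–834, arXiv:1101.4224, §2
  (`ℤ`, `ℚ`, `±2πi`, `π` parameter-free definable in any E-field with cyclic kernel).
* [Nesterenko1996SbMath] Yu. V. Nesterenko, *Modular functions and transcendence questions*,
  Sb. Math. 187 (1996) 1319–1348, Theorem 1 (`π, e^π, Γ(1/4)` algebraically independent;
  tree theorem `nesterenko_holds`).
* [Marker2002] D. Marker, *Model Theory: An Introduction*, Springer GTM 217, §1.3 and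
  Exercise 1.4.10 (`acl`, `dcl`; symmetric functions of finite definable sets).
-/

noncomputable section

open FirstOrder FirstOrder.Language Set
open Literature.ModelTheory.ExponentialFields

namespace Summit.Schanuel.Schanuel.Theorems.AclSubsetLogFreeCore.Negative

/-- `∅`-definable sets (of tuples) are stable under conjugation. -/
theorem conj_comp_mem_of_definable {α : Type*} {s : Set (α → ℂ)}
    (hs : (∅ : Set ℂ).Definable Language.expRing s) {v : α → ℂ} (hv : v ∈ s) :
    (starRingEnd ℂ) ∘ v ∈ s := by
  obtain ⟨φ, rfl⟩ := Set.empty_definable_iff.1 hs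
  have h := FirstOrder.Language.StrongHomClass.realize_formula conjLEquiv φ (v := v)
  exact h.2 hv

/-- `∅`-definable subsets of `ℂ` are `conj`-stable. [folklore] -/
theorem conj_mem_of_definable₁ {s : Set ℂ} (hs : Set.Definable₁ (∅ : Set ℂ) Language.expRing s)
    {a : ℂ} (ha : a ∈ s) : (starRingEnd ℂ) a ∈ s :=
  conj_comp_mem_of_definable hs (v := fun _ : Fin 1 => a) ha

/-- `acl(∅)` is `conj`-stable. [folklore] -/
theorem conj_mem_expAcl {a : ℂ} (ha : a ∈ expAcl) : (starRingEnd ℂ) a ∈ expAcl := by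
  obtain ⟨s, hs, hdef, has⟩ := ha
  exact ⟨s, hs, hdef, conj_mem_of_definable₁ hdef has⟩

/-- Pointwise `∅`-definable numbers are fixed by conjugation, -/
theorem conj_eq_of_mem_expDcl {a : ℂ} (ha : a ∈ expDcl) : (starRingEnd ℂ) a = a :=
  conj_mem_of_definable₁ ha rfl

/-- i.e. `dcl^{ℂ_exp}(∅) ⊆ ℝ`. -/
theorem expDcl_subset_range_ofReal : expDcl ⊆ Set.range ((↑) : ℝ → ℂ) := fun _ ha =>
  Complex.conj_eq_iff_real.1 (conj_eq_of_mem_expDcl ha) |>.imp fun _ h => h.symm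

/-- `2πi` is NOT pointwise `∅`-definable (it is not real), although `{±2πi}` is `∅`-definable. -/
theorem two_pi_I_not_mem_expDcl : (2 * ↑Real.pi * Complex.I : ℂ) ∉ expDcl := fun h => by
  obtain ⟨r, hr⟩ := expDcl_subset_range_ofReal h
  have := congrArg Complex.im hr
  simp [Real.pi_ne_zero] at this

/-- REFUTED MISREADING of the route's slogan: the core is NOT made of pointwise-definable numbers
(`C_EA ⊄ dcl(∅)`); only `C_EA ⊆ acl(∅)` (support item 0972) can hold. -/
theorem not_logFreeCore_subset_expDcl : ¬ ((logFreeCore : Set ℂ) ⊆ expDcl) := fun h =>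
  two_pi_I_not_mem_expDcl (h two_pi_I_mem_logFreeCore)

/-- Polynomial maps with integer coefficients are `∅`-definable functions. -/
theorem definableFun_mvPolynomial_aeval {n : ℕ} (Q : MvPolynomial (Fin n) ℤ) :
    (∅ : Set ℂ).DefinableFun Language.expRing (fun x : Fin n → ℂ => MvPolynomial.aeval x Q) := by
  induction Q using MvPolynomial.induction_on with
  | C a => simpa using definableFun_intCast' (A := (∅ : Set ℂ)) (α := Fin n) a
  | add p q hp hq => simpa using definableFun_add' hp hq
  | mul_X p i hp => simpa using definableFun_mul' hp (definableFun_proj_params i)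

/-- Specialising the universal root polynomial. [folklore] -/
theorem map_univRootPoly {n : ℕ} (x : Fin n → ℂ) :
    (univRootPoly n).map (MvPolynomial.aeval x).toRingHom =
      ∏ i, (Polynomial.X - Polynomial.C (x i)) := by
  simp [univRootPoly, Polynomial.map_prod]

/-- Coefficients of `∏ (X − xᵢ)` are integer polynomials in the `xᵢ`. [folklore] -/
theorem coeff_rootPoly_eq_aeval {n : ℕ} (x : Fin n → ℂ) (j : ℕ) :
    (∏ i, (Polynomial.X - Polynomial.C (x i))).coeff j =
      MvPolynomial.aeval x ((univRootPoly n).coeff j) := by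
  rw [← map_univRootPoly, Polynomial.coeff_map]; rfl

/-- The coefficients of `∏ (X − xᵢ)` are `∅`-definable functions of `(xᵢ)`. [folklore] -/
theorem definableFun_coeff_rootPoly (n j : ℕ) :
    (∅ : Set ℂ).DefinableFun Language.expRing
      (fun x : Fin n → ℂ => (∏ i, (Polynomial.X - Polynomial.C (x i))).coeff j) := by
  simp_rw [coeff_rootPoly_eq_aeval]; exact definableFun_mvPolynomial_aeval _

/-- For an `∅`-definable `s`, the set of `j`-th coefficients of `∏ (X − xᵢ)` over injective
`n`-tuples from `s` is `∅`-definable. -/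
theorem definable₁_coeffSet {s : Set ℂ} (hs : Set.Definable₁ (∅ : Set ℂ) Language.expRing s)
    (n j : ℕ) :
    Set.Definable₁ (∅ : Set ℂ) Language.expRing
      {c : ℂ | ∃ x : Fin n → ℂ, Function.Injective x ∧ (∀ i, x i ∈ s) ∧
        c = (∏ i, (Polynomial.X - Polynomial.C (x i))).coeff j} := by
  set S : Set (Fin 1 ⊕ Fin n → ℂ) :=
    {w | Function.Injective (fun i => w (Sum.inr i)) ∧ (∀ i, w (Sum.inr i) ∈ s) ∧
      w (Sum.inl 0) = (∏ i, (Polynomial.X - Polynomial.C (w (Sum.inr i)))).coeff j} with hSdef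
  have hS : (∅ : Set ℂ).Definable Language.expRing S := by
    refine definable_setOf_and_params ?_ (definable_setOf_and_params ?_ ?_)
    · have : {w : Fin 1 ⊕ Fin n → ℂ | Function.Injective (fun i => w (Sum.inr i))} =
          ⋂ i, ⋂ k, {w | w (Sum.inr i) = w (Sum.inr k) → i = k} := by
        ext w; simp [Function.Injective, Set.mem_iInter]
      rw [this]
      refine Set.definable_iInter_of_finite fun i => Set.definable_iInter_of_finite fun k => ?_
      refine definable_setOf_imp_params (definable_setOf_eq_params (definableFun_proj_params _)
        (definableFun_proj_params _)) ?_
      by_cases hik : i = k <;> simp [hik]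
    · have : {w : Fin 1 ⊕ Fin n → ℂ | ∀ i, w (Sum.inr i) ∈ s} = ⋂ i, {w | w (Sum.inr i) ∈ s} := by
        ext w; simp
      rw [this]
      exact Set.definable_iInter_of_finite fun i =>
        definable_mem_of_definable₁ hs (definableFun_proj_params _)
    · exact definable_setOf_eq_params (definableFun_proj_params _)
        (definableFun_reindex (definableFun_coeff_rootPoly n j) Sum.inr)
  have h := hS.exists_of_finite
  unfold Set.Definable₁
  convert h using 1
  ext v
  simp only [hSdef, Set.mem_setOf_eq, Sum.elim_inr, Sum.elim_inl]

/-- An injective enumeration of a finite set gives its root polynomial. [folklore] -/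
theorem prod_X_sub_C_eq_of_injective {s : Set ℂ} (hs : s.Finite) {x : Fin hs.toFinset.card → ℂ}
    (hx : Function.Injective x) (hxs : ∀ i, x i ∈ s) :
    ∏ i, (Polynomial.X - Polynomial.C (x i)) =
      ∏ y ∈ hs.toFinset, (Polynomial.X - Polynomial.C y) := by
  have himg : Finset.univ.image x = hs.toFinset := by
    apply Finset.eq_of_subset_of_card_le
    · intro y hy
      obtain ⟨i, -, rfl⟩ := Finset.mem_image.1 hy
      exact hs.mem_toFinset.2 (hxs i)
    · rw [Finset.card_image_of_injective _ hx]; simp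
  calc ∏ i, (Polynomial.X - Polynomial.C (x i))
      = ∏ y ∈ Finset.univ.image x, (Polynomial.X - Polynomial.C y) := by
        rw [Finset.prod_image fun i _ k _ h => hx h]
    _ = ∏ y ∈ hs.toFinset, (Polynomial.X - Polynomial.C y) := by rw [himg]

/-- **The coefficients of the root polynomial of a finite `∅`-definable set are `∅`-definable
points** (elementary symmetric functions, Marker Ex. 1.4.10-type folklore). -/
theorem coeff_mem_expDcl {s : Set ℂ} (hs : s.Finite)
    (hdef : Set.Definable₁ (∅ : Set ℂ) Language.expRing s) (j : ℕ) :
    (∏ y ∈ hs.toFinset, (Polynomial.X - Polynomial.C y)).coeff j ∈ expDcl := by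
  have hD := definable₁_coeffSet hdef hs.toFinset.card j
  have hinj : Function.Injective
      (fun i : Fin hs.toFinset.card => ((hs.toFinset.equivFin.symm i : hs.toFinset) : ℂ)) :=
    Subtype.val_injective.comp (Equiv.injective _)
  have hmem : ∀ i : Fin hs.toFinset.card,
      ((hs.toFinset.equivFin.symm i : hs.toFinset) : ℂ) ∈ s :=
    fun i => hs.mem_toFinset.1 (hs.toFinset.equivFin.symm i).2
  have heq : {c : ℂ | ∃ x : Fin hs.toFinset.card → ℂ, Function.Injective x ∧ (∀ i, x i ∈ s) ∧
      c = (∏ i, (Polynomial.X - Polynomial.C (x i))).coeff j} =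
      {(∏ y ∈ hs.toFinset, (Polynomial.X - Polynomial.C y)).coeff j} := by
    ext c
    simp only [Set.mem_setOf_eq, Set.mem_singleton_iff]
    constructor
    · rintro ⟨x, hx, hxs, rfl⟩
      rw [prod_X_sub_C_eq_of_injective hs hx hxs]
    · rintro rfl
      exact ⟨_, hinj, hmem, by rw [prod_X_sub_C_eq_of_injective hs hinj hmem]⟩
  show Set.Definable₁ _ _ _
  rw [← heq]; exact hD

/-- **Reduction of (A) to `dcl`**: if every pointwise `∅`-definable number lies in `C_EA`, so
does every element of a finite `∅`-definable set (it is a root of a monic polynomial whose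
coefficients are `∅`-definable points, and `C_EA` is relatively algebraically closed). -/
theorem expAcl_subset_of_expDcl_subset (h : expDcl ⊆ (logFreeCore : Set ℂ)) :
    expAcl ⊆ (logFreeCore : Set ℂ) := by
  rintro a ⟨s, hs, hdef, ha⟩
  set p : Polynomial ℂ := ∏ y ∈ hs.toFinset, (Polynomial.X - Polynomial.C y) with hp
  have hmonic : p.Monic :=
    Polynomial.monic_prod_of_monic _ _ fun y _ => Polynomial.monic_X_sub_C y
  have hpa : p.eval a = 0 := by
    rw [hp, Polynomial.eval_prod]
    exact Finset.prod_eq_zero (hs.mem_toFinset.2 ha) (by simp)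
  have hcoef : ∀ j, p.coeff j ∈ logFreeCore := fun j => h (coeff_mem_expDcl hs hdef j)
  have hlift : p ∈ Polynomial.lifts (algebraMap logFreeCore ℂ) := by
    rw [Polynomial.lifts_iff_coeff_lifts]
    intro j
    exact ⟨⟨_, hcoef j⟩, rfl⟩
  obtain ⟨q, hqmap, -, hqmonic⟩ := Polynomial.lifts_and_degree_eq_and_monic hlift hmonic
  have hqa : Polynomial.aeval a q = 0 := by
    rw [Polynomial.aeval_def, ← Polynomial.eval_map, hqmap]; exact hpa
  exact logFreeCore_mem_coreFamily.2.2 a ⟨q, hqmonic.ne_zero, hqa⟩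

/-- **(A) ⟺ `dcl^{ℂ_exp}(∅) ⊆ C_EA`.** -/
theorem aclSubsetLogFreeCore_iff_expDcl :
    Summit.Schanuel.Schanuel.Theses.RigidCore.AclSubsetLogFreeCore ↔
      expDcl ⊆ (logFreeCore : Set ℂ) :=
  ⟨fun h => expDcl_subset_expAcl.trans h, expAcl_subset_of_expDcl_subset⟩

/-- **(A) ⟺ every `∅`-definable REAL number of `ℂ_exp` lies in `C_EA`.** The crux is a
statement about the countable set `dcl^{ℂ_exp}(∅) ⊆ ℝ` of pointwise-definable reals. -/
theorem aclSubsetLogFreeCore_iff_real :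
    Summit.Schanuel.Schanuel.Theses.RigidCore.AclSubsetLogFreeCore ↔
      ∀ r : ℝ, (r : ℂ) ∈ expDcl → (r : ℂ) ∈ logFreeCore := by
  rw [aclSubsetLogFreeCore_iff_expDcl]
  constructor
  · exact fun h r hr => h hr
  · intro h a ha
    obtain ⟨r, rfl⟩ := expDcl_subset_range_ofReal ha
    exact h r ha

/-- `acl(∅)` is countable too (countably many formulas, each contributing one finite set): no
counting argument can separate the two sides of (A). -/
theorem countable_expAcl : expAcl.Countable := by
  let T : Language.expRing.Formula (Fin 1) → Set ℂ := fun φ =>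
    {b | ∃ s : Set ℂ, s.Finite ∧ {x : Fin 1 → ℂ | x 0 ∈ s} = setOf φ.Realize ∧ b ∈ s}
  have hsub : expAcl ⊆ ⋃ φ, T φ := by
    rintro a ⟨s, hs, hdef, ha⟩
    obtain ⟨φ, hφ⟩ := Set.empty_definable_iff.1 hdef
    exact Set.mem_iUnion.2 ⟨φ, s, hs, hφ, ha⟩
  have hT : ∀ φ, (T φ).Countable := by
    intro φ
    by_cases hex : ∃ s : Set ℂ, s.Finite ∧ {x : Fin 1 → ℂ | x 0 ∈ s} = setOf φ.Realize
    · obtain ⟨s, hs, hseq⟩ := hex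
      refine hs.countable.mono ?_
      rintro b ⟨s', -, hs'eq, hb⟩
      have hb' : (fun _ : Fin 1 => b) ∈ {x : Fin 1 → ℂ | x 0 ∈ s'} := hb
      rw [hs'eq, ← hseq] at hb'
      exact hb'
    · refine Set.countable_empty.mono ?_
      rintro b ⟨s', hs', hs'eq, -⟩
      exact (hex ⟨s', hs', hs'eq⟩).elim
  exact (Set.countable_iUnion hT).mono hsub

end Summit.Schanuel.Schanuel.Theorems.AclSubsetLogFreeCore.Negative
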